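import Summits.QuantumFields.YangMills.Theorems.BalabanUVNodesN22KnitDiscrete
import Summits.QuantumFields.YangMills.Theorems.BalabanUVNodesN22AtU3OfKernels
import Summits.QuantumFields.YangMills.Theorems.BalabanUVNodesN18UniformDecayOfStepRate

/-!
# BalabanUVNodes ∕ node N22 = NE9 — FADING MEMORY OF THE LIMITING KERNELS FROM NODE N18's KERNEL STEP RATE: K3⁷ v5 §2b's `h9` with the record's
# GEOMETRIC moduli `ℓ.moduli` from tower-NE5 of the kernels (zeroth-order fading) + the printed-type uniform kernel decay + UNIFORM second differences
# in each young coupling — dag-n22-a's discrete Landau–Kolmogorov knit (`N22KnitDiscrete`) AT THE KERNEL OBJECTS OF RECORD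

Cell `pub-ymgap`, HUMAN RULING D-0062 (Track A), R134 seat `pub-ymgap-dag-n22-c` (strategy s1), generation 14, module J38.  THEOREMS ONLY (no `def`, no `sorry`,
standard axioms); `--kind proof --supports stmt-QuantumFields-20544 --as helper` (K3⁷ `SpineGivenEndpointR13SepCoPH`, skeleton v5 941dddb108cb), COUNT-NEUTRAL.
Imports dag-n22-a's `…Theorems.BalabanUVNodesN22KnitDiscrete` (`ne9_and_fadingMemory_of_osc_secondDiff`, through it `Spine.NE9.MemoryFromRate.osc_le_of_towerRate`),
dag-n22-w3's `…Theorems.BalabanUVNodesN22AtU3OfKernels` (`n22At_rateCarriers_of_kernels_pin_of_ne9`) and dag-n18-w4's `…Theorems.BalabanUVNodesN18UniformDecayOfStepRate`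
(`prependCoupling_head_tail`, `decayBound_EA_of_kernelStepRate_of_base`: the uniform decay from the step rate + the level-0 base); node00-def-W1's W1-19 `Node00.U3OfKernels` ∕
W1-21 `Node00.U3KernelLetters` objects and letters BY NAME.  Nothing re-declared.

WHY (module J37 `…N22ModuliDominationAudit`).  K3⁷ v5 §2b's N22 input `h9 : NE9 ((objectsOfRecord₁₃ F 2 θ ℓ).EA 0) (Window θ.γ) ℓ.κ ℓ.moduli` carries the GEOMETRIC history
moduli `ℓ.moduli n i = ℓ.C₉·ℓ.ω^{n−i}` (`ℓ.ω < 1`).  The holomorphy roads of this lane deliver (β′) tables UNIFORM in the age (or parametrised by radii), and a uniform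
table dominated by `ℓ.moduli` is `≤ 0` (J37 §1–§2: the junction is vacuous modulo degenerate data) while a margin table forces age-growing radii (J37 §3).  So the
geometric gain must be GENUINE.  It IS — and it is ALREADY OWED TO THE SAME STUB: node N18's kernel step rate `KernelStepRateOfRecord₁₃ F N θ κ θ₅ C₅` (W1-21;
`…_iff_forall_ne5`: W1-19's `NE5 (EA …) (EB … b)` for every unpaired first coupling `b ∈ ]0, γ]`) says that prepending a coupling and going one level up moves a
kernel by `C₅θ₅^{k+1}e^{−κ|z|₁}`; peeling the `a` OLDEST couplings (dag-n22-a's `N22Knit.oscFading_of_towerNE5`, here through `MemoryFromRate.osc_le_of_towerRate` on the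
kernel carrier) gives OSCILLATION FADING `|Π_{k+1}(g; z) − Π_{k+1}(g′; z)| ≤ (2C₅∕(1−θ₅))·θ₅^{k+1−a}·e^{−κ|z|₁}` for histories agreeing from index `a ≤ k` — fading
memory at ZEROTH order; at `a = k + 1` (the youngest coupling) the printed-type uniform kernel decay `DecayBound (EA …) (Window γ) E₀ κ` ([I] (1.18)∕(5.10), UNIFORM in the
history — the uniform edition of the (D4) road's `KernelDecayOfRecord₁₃`) gives `2E₀·e^{−κ|z|₁}`.  dag-n22-a's DISCRETE LANDAU–KOLMOGOROV step
(`N22KnitDiscrete.ne9_and_fadingMemory_of_osc_secondDiff`) then converts oscillation `C₀θ₅^{age}` + SECOND DIFFERENCES `≤ M·e^{−κ|z|₁}·d²` in each young coupling on `]0, γ]`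
(constant `M` UNIFORM in the age — exactly what Cauchy at second order gives from UNIFORM output-level coupling margins: module J39) into
**`NE9 (EA …) (Window γ) κ Λ₁ ∧ FadingMemory C₉ τ Λ₁`**, `Λ₁ k i = C₉·τ^{k−i}`, for every step ratio `ϱ ∈ ]0, 1]` and rate `τ > 0` with `θ₅ ≤ τϱ`, `ϱ ≤ τ`
(`C₉ = (4C₀∕γ + Mγ∕2)∕τ`, `C₀ = 2C₅∕(1−θ₅) + 2E₀`); at the record, with `τ = ϱ := ℓ.ω`: `h9` with `ℓ.moduli` under the SATISFIABLE letter rows `0 < ℓ.ω`, `ℓ.θ₅ ≤ ℓ.ω²`,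
`ℓ.κ ≤ κ`, `(4C₀∕γ + Mγ∕2)∕ℓ.ω ≤ ℓ.C₉`.  NO age-growing radii, NO activity-level slot, NO `StepLipschitz` smallness `ω + c < 1` of ROAD 1.
* §0 `ne9_mono` — `T4OutputRate.NE9` is monotone (rate down, moduli up).
* §1 generic term family `ℰ`: `prefixDependenceOn_EA` ((P) holds BY CONSTRUCTION: `kernelA g k` reads `histPrefix g k`); `towerRate_kernelA_of_kernelStepRate` (the peeling step);
  ★ `osc_EA_of_kernelStepRate_decayBound` ((O) from N18's letter + (1.18)); ★★★ `ne9_and_fadingMemory_EA_of_kernelStepRate_secondDiff`; ★★ `…_base_secondDiff` (the uniform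
  decay replaced by the level-0 (5.10) base, dag-n18-w4's telescope BY NAME).
* §2 AT THE RECORD: ★★★ `ne9_EA_objectsOfRecord₁₃_of_kernelStepRate_secondDiff` (= v5 §2b `h9`, moduli `ℓ.moduli` BY NAME) and the pin face
  `n22At_rateCarriers_of_kernels_pin_of_kernelStepRate_secondDiff` (`N22At (rateCarriersOfRecord₁₃CoPH 𝔯 F θ hP g₀ os k).u3`, every `k`, under v5's `U3PinnedKernels`).
* §3 THE KERNEL SECOND-DIFFERENCE LETTER FROM WINDOWED SECOND DIFFERENCES + (1.21) EXISTENCE (`abs_secondDiff_le_of_tendsto`, `update_mem_window`,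
  ★ `kernelSecondDiff_of_windowed`) — the producer side one level down (the windowed letter is module J39's, from output-level margins with UNIFORM radii).

HONEST FRAMING (binding).  Count-neutral COMPOSITION of landed theorems by name; NO estimate of Bałaban's is proved or asserted; every displayed input is a HYPOTHESIS with its
owner — the kernel step rate: node N18 (NE5 at every pair of run lengths, NOT PRINTED for d = 4; print: [I] Thm 1 p. 259 uniformity in the spacing); the uniform kernel decay:
(1.18)∕(5.10) of record through the (D4) road (NODE A ∕ N09 ∕ N10); the second-difference letter: the «(or analytic)» clause of [I] p. 263 ∕ p. 266 read at second order with a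
UNIFORM constant (N09 ∕ N10 at output level ∕ NODE A; unprinted for the older couplings); (1.21) existence: dag-n22-w3's road; nothing of the record is constructed or claimed to
meet them; N22 is NOT discharged (typed 28∕28 · discharged 5∕27 UNCHANGED); K3⁷ OPEN and NOT claimed; NE9 is NOT IN PRINT for d = 4; no count claim; one finite 𝕋⁴ programme at
fixed ε — R4 closes the CONDITIONAL rung `BalabanLadder.UV` only; NOTHING about the continuum limit, ℝ⁴, infinite volume, OS axioms, a mass gap or the Clay problem is proved or
claimed.  References (TYPES only, no cite tags on the Summit side): [I] = Bałaban, CMP 109 (1987) (0.23) p. 256, Thm 1 p. 259, (1.18) p. 263, (1.20)–(1.22) p. 264, §5 p. 298,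
(5.10) p. 293; [II] = CMP 116 (1988) (2.13)–(2.14) pp. 14–15.
-/

noncomputable section

open Filter Topology Set
open scoped BigOperators

namespace YMDAG.N22.KernelFading

open Literature.MathematicalPhysics.QuantumFieldTheory.Balaban1983to89
open Literature.MathematicalPhysics.QuantumFieldTheory.Balaban1983to89.T4Continuum (T4Family ULoop)
open Literature.MathematicalPhysics.QuantumFieldTheory.Balaban1983to89.T4OutputRate (Carriers Functional Window NE9 FadingMemory DecayBound PrefixDependenceOn NE5)
open Literature.MathematicalPhysics.QuantumFieldTheory.Balaban1983to89.Node00 (TermFamily1 polWindow polLimit PolLimitExists tendsto_polLimit mergedTermFamilyMatT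
  TβOfRecord₁₃ chiβOfRecord₁₃ Stage13Params Stage13HParams U3Letters₁₁ U3Objects₁₁ prependCoupling)
open Literature.MathematicalPhysics.QuantumFieldTheory.Balaban1983to89.Node00.U3OfKernels (carriers pt histPrefix kernelA EA objectsOfRecord₁₃ kernelA_eq kernelA_congr
  prependCoupling_mem_window EA_apply)
open Literature.MathematicalPhysics.QuantumFieldTheory.Balaban1983to89.Node00.U3KernelLetters (KernelStepRate KernelStepRateOfRecord₁₃ PolLimitsExistOfRecord₁₃)
open Literature.MathematicalPhysics.QuantumFieldTheory.Balaban1983to89.B12Sec2to5 (l1 l1_nonneg)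
open YMDAG.UVSplit (N22At RateReading₁₃CoPH rateCarriersOfRecord₁₃CoPH)
open YMDAG.N22.AtKernels (n22At_rateCarriers_of_kernels_pin_of_ne9)
open Summit.QuantumFields.BalabanUV.T4Continuum.NE9.MemoryFromRate (osc_le_of_towerRate shift_mem_window)
open Summit.QuantumFields.YangMills.BalabanUVNodes.N22KnitDiscrete (ne9_and_fadingMemory_of_osc_secondDiff)
open YMDAG.N18.UniformDecayOfStepRate (prependCoupling_head_tail decayBound_EA_of_kernelStepRate_of_base)

open scoped Matrix.Norms.L2Operator

/-! ## §0 `NE9` is monotone in the rate and the moduli -/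

/-- **MONOTONICITY OF `T4OutputRate.NE9`**: rate down (`κ′ ≤ κ`), moduli up (`Λ ≤ Λ′`, `Λ′ ≥ 0`). [folklore] -/
theorem ne9_mono {C : Carriers} {Bg : Type} {E : Functional C Bg} {W : Set (ℕ → ℝ)} {κ κ' : ℝ} {Λ Λ' : ℕ → ℕ → ℝ} (h : NE9 E W κ Λ) (hκ : κ' ≤ κ)
    (hΛ : ∀ k i, Λ k i ≤ Λ' k i) (hΛ' : ∀ k i, 0 ≤ Λ' k i) : NE9 E W κ' Λ' := by
  intro g hg g' hg' U X
  refine (h g hg g' hg' U X).trans ?_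
  have hS : ∑ i ∈ Finset.range (C.scale X), Λ (C.scale X) i * |g i - g' i| ≤ ∑ i ∈ Finset.range (C.scale X), Λ' (C.scale X) i * |g i - g' i| :=
    Finset.sum_le_sum fun i _ => mul_le_mul_of_nonneg_right (hΛ _ _) (abs_nonneg _)
  have hS' : 0 ≤ ∑ i ∈ Finset.range (C.scale X), Λ' (C.scale X) i * |g i - g' i| :=
    Finset.sum_nonneg fun i _ => mul_nonneg (hΛ' _ _) (abs_nonneg _)
  have hexp : Real.exp (-(κ * C.d X)) ≤ Real.exp (-(κ' * C.d X)) :=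
    Real.exp_le_exp.2 (neg_le_neg (mul_le_mul_of_nonneg_right hκ (C.d_nonneg X)))
  exact (mul_le_mul_of_nonneg_left hS (Real.exp_nonneg _)).trans (mul_le_mul_of_nonneg_right hexp hS')

/-! ## §1 Generic term family `ℰ`: (P), (O) from node N18's kernel step rate + uniform decay, and the knit -/

section Generic

variable {𝔄 : Type*} [NormedRing 𝔄] [NormedAlgebra ℝ 𝔄]
variable {V : Type*} [NormedAddCommGroup V] [NormedSpace ℝ V] {ι : Type*} [Fintype ι]
variable (F : T4Family) (ℰ : TermFamily1 F 𝔄) (ρ : V →L[ℝ] 𝔄) (bV : Module.Basis ι ℝ V)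

/-- **(P) HOLDS BY CONSTRUCTION**: run A's kernel functional reads the history below the scale only — `kernelA g k = polLimit (ℰ k (histPrefix g k))` (W1-19 `kernelA_congr`);
so `PrefixDependenceOn (EA F ℰ ρ bV) W` on ANY window. [folklore] -/
theorem prefixDependenceOn_EA (W : Set (ℕ → ℝ)) : PrefixDependenceOn (EA F ℰ ρ bV) W := by
  intro g _ g' _ U X h
  rw [EA_apply, EA_apply]
  exact congrFun (congrFun (congrFun (kernelA_congr F ℰ ρ bV (k := X.1) h) X.2.1) X.2.2.1) X.2.2.2

/-- **THE PEELING STEP** (node N18's letter read as a tower rate on the kernel carrier): with `F_z n h := e^{κ|z|₁}·Π_{n+1}(h; z)`, the kernel step rate gives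
`|F_z (n+1) g − F_z n (g ∘ succ)| ≤ (C₅θ)·θ^n` for every window history `g` — dropping the OLDEST coupling lowers the level by one. [folklore] -/
theorem towerRate_kernelA_of_kernelStepRate {γ κ θ C₅ : ℝ} (h5 : KernelStepRate F ℰ ρ bV γ κ θ C₅) (μ ν : Fin 4) (z : Fin 4 → ℤ) :
    ∀ n : ℕ, ∀ g ∈ Window γ,
      |Real.exp (κ * l1 z) * kernelA F ℰ ρ bV g (n + 1) μ ν z - Real.exp (κ * l1 z) * kernelA F ℰ ρ bV (fun i => g (i + 1)) n μ ν z| ≤ C₅ * θ * θ ^ n := by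
  intro n g hg
  have hpos : 0 < Real.exp (κ * l1 z) := Real.exp_pos _
  have h := h5 (g 0) (hg 0).1 (hg 0).2 (fun i => g (i + 1)) (shift_mem_window hg) n μ ν z
  rw [prependCoupling_head_tail] at h
  rw [← mul_sub, abs_mul, abs_of_pos hpos, abs_sub_comm]
  calc Real.exp (κ * l1 z) * |kernelA F ℰ ρ bV (fun i => g (i + 1)) n μ ν z - kernelA F ℰ ρ bV g (n + 1) μ ν z|
      ≤ Real.exp (κ * l1 z) * (C₅ * θ ^ (n + 1) * Real.exp (-(κ * l1 z))) := mul_le_mul_of_nonneg_left h hpos.le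
    _ = C₅ * θ * θ ^ n := by rw [Real.exp_neg, pow_succ]; field_simp

/-- ★ **(O) OSCILLATION FADING OF THE KERNEL FUNCTIONAL from node N18's kernel step rate + the printed-type UNIFORM kernel decay.**  Two window histories agreeing at every
index `≥ a`, `a ≤ k + 1`, have level-`(k+1)` kernels within `(2C₅∕(1−θ) + 2E₀)·θ^{k+1−a}·e^{−κ|z|₁}`: for `a ≤ k` peel the `a` oldest couplings
(`MemoryFromRate.osc_le_of_towerRate` on §1's tower rate — dag-n22-a's `N22Knit.oscFading_of_towerNE5` in kernel currency); for `a = k + 1` the decay bound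
`DecayBound (EA …) (Window γ) E₀ κ` ([I] (1.18), uniform in the history) alone. [folklore] -/
theorem osc_EA_of_kernelStepRate_decayBound {γ κ θ C₅ E₀ : ℝ} (hC₅ : 0 ≤ C₅) (hθ0 : 0 ≤ θ) (hθ1 : θ < 1) (hE₀ : 0 ≤ E₀)
    (h5 : KernelStepRate F ℰ ρ bV γ κ θ C₅) (hdec : DecayBound (EA F ℰ ρ bV) (Window γ) E₀ κ) :
    ∀ g ∈ Window γ, ∀ g' ∈ Window γ, ∀ (U : PUnit) (X : carriers.Dom) (a : ℕ), a ≤ carriers.scale X →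
      (∀ n, a ≤ n → g n = g' n) →
      |EA F ℰ ρ bV g U X - EA F ℰ ρ bV g' U X| ≤ (2 * C₅ / (1 - θ) + 2 * E₀) * θ ^ (carriers.scale X - a) * Real.exp (-(κ * carriers.d X)) := by
  intro g hg g' hg' U X a ha hagree
  obtain ⟨k, μ, ν, z⟩ := X
  dsimp only at ha ⊢
  rw [EA_apply, EA_apply]
  have h1θ : 0 < 1 - θ := by linarith
  have hexp : 0 ≤ Real.exp (-(κ * l1 z)) := Real.exp_nonneg _
  rcases Nat.lt_or_ge a (k + 1) with hak | hak
  · -- `a ≤ k`: peel the `a` oldest couplings from level `k = m + a`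
    obtain ⟨m, rfl⟩ : ∃ m, k = m + a := ⟨k - a, by omega⟩
    have hT := towerRate_kernelA_of_kernelStepRate F ℰ ρ bV h5 μ ν z
    have hosc := osc_le_of_towerRate (W := Window γ)
      (F := fun n h => Real.exp (κ * l1 z) * kernelA F ℰ ρ bV h n μ ν z) (mul_nonneg hC₅ hθ0) hθ0 hθ1
      (fun g hg => shift_mem_window hg) hT (a := a) (m := m) hg hg' hagree
    have hpos : 0 < Real.exp (κ * l1 z) := Real.exp_pos _
    rw [← mul_sub, abs_mul, abs_of_pos hpos] at hosc
    have key : |kernelA F ℰ ρ bV g (m + a) μ ν z - kernelA F ℰ ρ bV g' (m + a) μ ν z| ≤ 2 * (C₅ * θ) * θ ^ m / (1 - θ) * Real.exp (-(κ * l1 z)) := by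
      rw [Real.exp_neg, ← div_eq_mul_inv, le_div_iff₀ hpos, mul_comm]
      exact hosc
    have e : m + a + 1 - a = m + 1 := by omega
    rw [e]
    calc |kernelA F ℰ ρ bV g (m + a) μ ν z - kernelA F ℰ ρ bV g' (m + a) μ ν z|
        ≤ 2 * (C₅ * θ) * θ ^ m / (1 - θ) * Real.exp (-(κ * l1 z)) := key
      _ = 2 * C₅ / (1 - θ) * θ ^ (m + 1) * Real.exp (-(κ * l1 z)) := by rw [pow_succ]; field_simp
      _ ≤ (2 * C₅ / (1 - θ) + 2 * E₀) * θ ^ (m + 1) * Real.exp (-(κ * l1 z)) := by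
          have : 0 ≤ 2 * E₀ * θ ^ (m + 1) * Real.exp (-(κ * l1 z)) := by positivity
          nlinarith
  · -- `a = k + 1`: the two kernels are each `≤ E₀ e^{−κ|z|₁}`
    have haeq : a = k + 1 := le_antisymm ha hak
    subst haeq
    rw [Nat.sub_self, pow_zero, mul_one]
    have h1 := hdec g hg U (k, μ, ν, z)
    have h2 := hdec g' hg' U (k, μ, ν, z)
    rw [EA_apply] at h1 h2
    dsimp only at h1 h2
    have h3 : 0 ≤ 2 * C₅ / (1 - θ) * Real.exp (-(κ * l1 z)) := by positivity
    calc |kernelA F ℰ ρ bV g k μ ν z - kernelA F ℰ ρ bV g' k μ ν z|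
        ≤ |kernelA F ℰ ρ bV g k μ ν z| + |kernelA F ℰ ρ bV g' k μ ν z| := abs_sub _ _
      _ ≤ E₀ * Real.exp (-(κ * l1 z)) + E₀ * Real.exp (-(κ * l1 z)) := add_le_add h1 h2
      _ ≤ (2 * C₅ / (1 - θ) + 2 * E₀) * Real.exp (-(κ * l1 z)) := by nlinarith

/-- ★★★ **NE9 ∧ FADING MEMORY OF THE KERNEL FUNCTIONAL FROM NODE N18's KERNEL STEP RATE + UNIFORM DECAY + UNIFORM SECOND DIFFERENCES.**  For a term family `ℰ` on the window
`]0, γ]^ℕ` (`γ > 0`): (N18) `KernelStepRate F ℰ ρ bV γ κ θ C₅` (`C₅ ≥ 0`, `0 ≤ θ < 1`); (1.18) `DecayBound (EA F ℰ ρ bV) (Window γ) E₀ κ` (`E₀ ≥ 0`); (R₂) SECOND DIFFERENCES of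
every kernel entry in every young coupling `i ≤ k` on `]0, γ]`, `|Π_{k+1}(g[i ↦ t+d]; z) − 2Π_{k+1}(g[i ↦ t]; z) + Π_{k+1}(g[i ↦ t−d]; z)| ≤ M·e^{−κ|z|₁}·d²` (`M ≥ 0`, UNIFORM in the
age); a step ratio `ϱ ∈ ]0, 1]` and a rate `τ > 0` with `θ ≤ τϱ`, `ϱ ≤ τ` ⟹ **`NE9 (EA F ℰ ρ bV) (Window γ) κ Λ₁ ∧ FadingMemory C₉ τ Λ₁`**, `Λ₁ k i = C₉·τ^{k−i}`,
`C₉ = (4C₀∕γ + Mγ∕2)∕τ`, `C₀ = 2C₅∕(1−θ) + 2E₀` — dag-n22-a's `N22KnitDiscrete.ne9_and_fadingMemory_of_osc_secondDiff` at §1's (P) and (O).  GEOMETRIC moduli from a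
UNIFORM regularity constant: the gain is the step rate's. [folklore] -/
theorem ne9_and_fadingMemory_EA_of_kernelStepRate_secondDiff {γ κ θ C₅ E₀ M ϱ τ : ℝ}
    (hC₅ : 0 ≤ C₅) (hθ0 : 0 ≤ θ) (hθ1 : θ < 1) (hE₀ : 0 ≤ E₀) (hM : 0 ≤ M) (hγ : 0 < γ)
    (h5 : KernelStepRate F ℰ ρ bV γ κ θ C₅) (hdec : DecayBound (EA F ℰ ρ bV) (Window γ) E₀ κ)
    (hR2 : ∀ g ∈ Window γ, ∀ (k : ℕ) (μ ν : Fin 4) (z : Fin 4 → ℤ) (i : ℕ), i < k + 1 → ∀ t d : ℝ, 0 < d →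
      t - d ∈ Ioc (0 : ℝ) γ → t + d ∈ Ioc (0 : ℝ) γ →
        |kernelA F ℰ ρ bV (Function.update g i (t + d)) k μ ν z - 2 * kernelA F ℰ ρ bV (Function.update g i t) k μ ν z +
            kernelA F ℰ ρ bV (Function.update g i (t - d)) k μ ν z| ≤ M * Real.exp (-(κ * l1 z)) * d ^ 2)
    (hϱ0 : 0 < ϱ) (hϱ1 : ϱ ≤ 1) (hθτϱ : θ ≤ τ * ϱ) (hϱτ : ϱ ≤ τ) (hτ0 : 0 < τ) :
    NE9 (EA F ℰ ρ bV) (Window γ) κ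
        (fun k i => (4 * (2 * C₅ / (1 - θ) + 2 * E₀) / γ + M * γ / 2) / τ * τ ^ (k - i)) ∧
      FadingMemory ((4 * (2 * C₅ / (1 - θ) + 2 * E₀) / γ + M * γ / 2) / τ) τ
        (fun k i => (4 * (2 * C₅ / (1 - θ) + 2 * E₀) / γ + M * γ / 2) / τ * τ ^ (k - i)) := by
  have h1θ : 0 < 1 - θ := by linarith
  have hC₀ : 0 ≤ 2 * C₅ / (1 - θ) + 2 * E₀ := by positivity
  have hR2' : ∀ g ∈ Window γ, ∀ (U : PUnit) (X : carriers.Dom) (i : ℕ), i < carriers.scale X → ∀ t d : ℝ, 0 < d →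
      t - d ∈ Ioc (0 : ℝ) γ → t + d ∈ Ioc (0 : ℝ) γ →
        |EA F ℰ ρ bV (Function.update g i (t + d)) U X - 2 * EA F ℰ ρ bV (Function.update g i t) U X +
            EA F ℰ ρ bV (Function.update g i (t - d)) U X| ≤
          M * (1 : ℝ) ^ (carriers.scale X - 1 - i) * Real.exp (-(κ * carriers.d X)) * d ^ 2 := by
    intro g hg U X i hi t d hd hm hp
    obtain ⟨k, μ, ν, z⟩ := X
    rw [EA_apply, EA_apply, EA_apply, one_pow, mul_one]
    exact hR2 g hg k μ ν z i hi t d hd hm hp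
  exact ne9_and_fadingMemory_of_osc_secondDiff (C := carriers) (E := EA F ℰ ρ bV) (prefixDependenceOn_EA F ℰ ρ bV (Window γ))
    (osc_EA_of_kernelStepRate_decayBound F ℰ ρ bV hC₅ hθ0 hθ1 hE₀ h5 hdec) hR2' hC₀ hθ0 hM zero_le_one hγ hϱ0 hϱ1 hθτϱ
    (by rwa [one_mul]) hτ0

/-- ★★ **THE SAME WITH THE LEVEL-0 BASE IN PLACE OF THE UNIFORM DECAY** — dag-n18-w4's `decayBound_EA_of_kernelStepRate_of_base` BY NAME: node N18's step rate + the level-0 (5.10)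
class `Decay510 (Π_1(g; ·)) E₀ κ` on the window already give `DecayBound (EA …) (Window γ) (E₀ + C₅θ∕(1−θ)) κ`, so N22's kernel letter with GEOMETRIC moduli reads: N18's kernel
step rate + the level-0 decay + UNIFORM second differences (`C₀ = 2C₅∕(1−θ) + 2(E₀ + C₅θ∕(1−θ))`). [folklore] -/
theorem ne9_and_fadingMemory_EA_of_kernelStepRate_base_secondDiff {γ κ θ C₅ E₀ M ϱ τ : ℝ}
    (hC₅ : 0 ≤ C₅) (hθ0 : 0 ≤ θ) (hθ1 : θ < 1) (hE₀ : 0 ≤ E₀) (hM : 0 ≤ M) (hγ : 0 < γ)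
    (h5 : KernelStepRate F ℰ ρ bV γ κ θ C₅)
    (h0 : ∀ g ∈ Window γ, ∀ (μ ν : Fin 4), B12Sec2to5.Decay510 (kernelA F ℰ ρ bV g 0 μ ν) E₀ κ)
    (hR2 : ∀ g ∈ Window γ, ∀ (k : ℕ) (μ ν : Fin 4) (z : Fin 4 → ℤ) (i : ℕ), i < k + 1 → ∀ t d : ℝ, 0 < d →
      t - d ∈ Ioc (0 : ℝ) γ → t + d ∈ Ioc (0 : ℝ) γ →
        |kernelA F ℰ ρ bV (Function.update g i (t + d)) k μ ν z - 2 * kernelA F ℰ ρ bV (Function.update g i t) k μ ν z +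
            kernelA F ℰ ρ bV (Function.update g i (t - d)) k μ ν z| ≤ M * Real.exp (-(κ * l1 z)) * d ^ 2)
    (hϱ0 : 0 < ϱ) (hϱ1 : ϱ ≤ 1) (hθτϱ : θ ≤ τ * ϱ) (hϱτ : ϱ ≤ τ) (hτ0 : 0 < τ) :
    NE9 (EA F ℰ ρ bV) (Window γ) κ
        (fun k i => (4 * (2 * C₅ / (1 - θ) + 2 * (E₀ + C₅ * (θ / (1 - θ)))) / γ + M * γ / 2) / τ * τ ^ (k - i)) ∧
      FadingMemory ((4 * (2 * C₅ / (1 - θ) + 2 * (E₀ + C₅ * (θ / (1 - θ)))) / γ + M * γ / 2) / τ) τ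
        (fun k i => (4 * (2 * C₅ / (1 - θ) + 2 * (E₀ + C₅ * (θ / (1 - θ)))) / γ + M * γ / 2) / τ * τ ^ (k - i)) := by
  have h1θ : 0 < 1 - θ := by linarith
  have hE₀' : 0 ≤ E₀ + C₅ * (θ / (1 - θ)) := by positivity
  exact ne9_and_fadingMemory_EA_of_kernelStepRate_secondDiff F ℰ ρ bV hC₅ hθ0 hθ1 hE₀' hM hγ h5
    (decayBound_EA_of_kernelStepRate_of_base F ρ bV hθ0 hθ1 hC₅ h5 h0) hR2 hϱ0 hϱ1 hθτϱ hϱτ hτ0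

end Generic

/-! ## §2 AT THE RECORD: K3⁷ v5 §2b's `h9` with the record's GEOMETRIC moduli, and the N22 pin face -/

section Record

variable (F : T4Family) (N : ℕ) [NeZero N]

/-- ★★★ **K3⁷ v5 §2b's `h9` WITH THE RECORD's MODULI `ℓ.moduli` FROM NODE N18's KERNEL STEP RATE OF RECORD + UNIFORM KERNEL DECAY + UNIFORM SECOND DIFFERENCES.**  At a Stage-13
parameter tuple `θ` with `0 < θ.γ` and a letter block `ℓ` with its signs: (N18) `KernelStepRateOfRecord₁₃ F N θ κ ℓ.θ₅ C₅` (node N18's kernel letter of record at the block's own NE5 rate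
`ℓ.θ₅`, `C₅ ≥ 0`); (1.18) `DecayBound ((objectsOfRecord₁₃ F N θ ℓ).EA 0) (Window θ.γ) E₀ κ` (uniform kernel decay, `E₀ ≥ 0`); (R₂) second differences of the kernel functional of
record in every young coupling on `]0, θ.γ]` bounded by `M·e^{−κd}·d²` (`M ≥ 0`); the LETTER ROWS `0 < ℓ.ω`, `ℓ.θ₅ ≤ ℓ.ω²`, `ℓ.κ ≤ κ`,
`(4·(2C₅∕(1−ℓ.θ₅) + 2E₀)∕θ.γ + M·θ.γ∕2)∕ℓ.ω ≤ ℓ.C₉` ⟹ **`NE9 ((objectsOfRecord₁₃ F N θ ℓ).EA 0) (Window θ.γ) ℓ.κ ℓ.moduli`** — §1 at `τ = ϱ := ℓ.ω`, then `ne9_mono`.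
The rows are jointly satisfiable with `ℓ.Signs` (`ℓ.ω ∈ [√ℓ.θ₅, 1[`, `ℓ.C₉` large): NO vacuity at the junction.  LOCATED (hypothesis form); N22 NOT discharged. [folklore] -/
theorem ne9_EA_objectsOfRecord₁₃_of_kernelStepRate_secondDiff (θ : Stage13Params F N) (ℓ : U3Letters₁₁) (hs : ℓ.Signs) (hγ : 0 < θ.γ)
    {κ C₅ E₀ M : ℝ} (hC₅ : 0 ≤ C₅) (hE₀ : 0 ≤ E₀) (hM : 0 ≤ M)
    (h5 : KernelStepRateOfRecord₁₃ F N θ κ ℓ.θ₅ C₅)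
    (hdec : DecayBound ((objectsOfRecord₁₃ F N θ ℓ).EA 0) (Window θ.γ) E₀ κ)
    (hR2 : ∀ g ∈ Window θ.γ, ∀ (U : PUnit) (X : ((objectsOfRecord₁₃ F N θ ℓ).levelCarriers 0).Dom) (i : ℕ),
      i < ((objectsOfRecord₁₃ F N θ ℓ).levelCarriers 0).scale X → ∀ t d : ℝ, 0 < d → t - d ∈ Ioc (0 : ℝ) θ.γ → t + d ∈ Ioc (0 : ℝ) θ.γ →
        |(objectsOfRecord₁₃ F N θ ℓ).EA 0 (Function.update g i (t + d)) U X - 2 * (objectsOfRecord₁₃ F N θ ℓ).EA 0 (Function.update g i t) U X +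
            (objectsOfRecord₁₃ F N θ ℓ).EA 0 (Function.update g i (t - d)) U X| ≤
          M * Real.exp (-(κ * ((objectsOfRecord₁₃ F N θ ℓ).levelCarriers 0).d X)) * d ^ 2)
    (hω : 0 < ℓ.ω) (hθω : ℓ.θ₅ ≤ ℓ.ω ^ 2) (hκ : ℓ.κ ≤ κ)
    (hC₉ : (4 * (2 * C₅ / (1 - ℓ.θ₅) + 2 * E₀) / θ.γ + M * θ.γ / 2) / ℓ.ω ≤ ℓ.C₉) :
    NE9 ((objectsOfRecord₁₃ F N θ ℓ).EA 0) (Window θ.γ) ℓ.κ ℓ.moduli := by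
  letI := θ.instVβ₁; letI := θ.instVβ₂; letI := θ.instιβ
  have hR2' : ∀ g ∈ Window θ.γ, ∀ (k : ℕ) (μ ν : Fin 4) (z : Fin 4 → ℤ) (i : ℕ), i < k + 1 → ∀ t d : ℝ, 0 < d →
      t - d ∈ Ioc (0 : ℝ) θ.γ → t + d ∈ Ioc (0 : ℝ) θ.γ →
        |kernelA F (mergedTermFamilyMatT F N (TβOfRecord₁₃ F N) (chiβOfRecord₁₃ F N θ) θ.εbg) θ.ρ8 θ.bV (Function.update g i (t + d)) k μ ν z -
            2 * kernelA F (mergedTermFamilyMatT F N (TβOfRecord₁₃ F N) (chiβOfRecord₁₃ F N θ) θ.εbg) θ.ρ8 θ.bV (Function.update g i t) k μ ν z +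
            kernelA F (mergedTermFamilyMatT F N (TβOfRecord₁₃ F N) (chiβOfRecord₁₃ F N θ) θ.εbg) θ.ρ8 θ.bV (Function.update g i (t - d)) k μ ν z| ≤
          M * Real.exp (-(κ * l1 z)) * d ^ 2 :=
    fun g hg k μ ν z i hi t d hd hm hp => hR2 g hg PUnit.unit (k, μ, ν, z) i hi t d hd hm hp
  have h := ne9_and_fadingMemory_EA_of_kernelStepRate_secondDiff F
    (mergedTermFamilyMatT F N (TβOfRecord₁₃ F N) (chiβOfRecord₁₃ F N θ) θ.εbg) θ.ρ8 θ.bV hC₅ hs.θ₅_pos.le hs.θ₅_lt_one hE₀ hM hγ h5 hdec hR2'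
    hω hs.ω_lt_one.le (by rw [← sq]; exact hθω) le_rfl hω
  refine ne9_mono h.1 hκ (fun k i => ?_) (hs.moduli_nonneg)
  rw [U3Letters₁₁.moduli_apply]
  exact mul_le_mul_of_nonneg_right hC₉ (pow_nonneg hs.ω_nonneg _)

open Classical in
/-- ★★★ **THE N22 PIN FACE**: under K3⁷ v5's node-U3 pin at the tuple (`hpin`), §2's inputs at `θ.toStage13Params` give `N22At (rateCarriersOfRecord₁₃CoPH 𝔯 F θ hP g₀ os k).u3` for EVERY
run length `k` — dag-n22-w3's `n22At_rateCarriers_of_kernels_pin_of_ne9` fed with `ne9_EA_objectsOfRecord₁₃_of_kernelStepRate_secondDiff`.  THE N22 ROW SENTENCE in this currency: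
«node N18's kernel step rate of record + uniform kernel decay + uniform second differences in each young coupling + letter rows ⇒ v5 §2b `h9` ∕ `N22At` at the pinned bundle».
LOCATED (hypothesis form); N22 NOT discharged. [folklore] -/
theorem n22At_rateCarriers_of_kernels_pin_of_kernelStepRate_secondDiff (𝔯 : RateReading₁₃CoPH N) (θ : Stage13HParams F N) (hP : θ.Provisos₁₃CoPH F N)
    (g₀ : ℕ → ℝ) (os : List (ULoop F)) (ℓ : U3Letters₁₁) (hs : ℓ.Signs) (hγ : 0 < θ.γ)
    (hpin : (𝔯.lit F θ hP g₀ os).u3 = objectsOfRecord₁₃ F N θ.toStage13Params ℓ)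
    {κ C₅ E₀ M : ℝ} (hC₅ : 0 ≤ C₅) (hE₀ : 0 ≤ E₀) (hM : 0 ≤ M)
    (h5 : KernelStepRateOfRecord₁₃ F N θ.toStage13Params κ ℓ.θ₅ C₅)
    (hdec : DecayBound ((objectsOfRecord₁₃ F N θ.toStage13Params ℓ).EA 0) (Window θ.γ) E₀ κ)
    (hR2 : ∀ g ∈ Window θ.γ, ∀ (U : PUnit) (X : ((objectsOfRecord₁₃ F N θ.toStage13Params ℓ).levelCarriers 0).Dom) (i : ℕ),
      i < ((objectsOfRecord₁₃ F N θ.toStage13Params ℓ).levelCarriers 0).scale X → ∀ t d : ℝ, 0 < d → t - d ∈ Ioc (0 : ℝ) θ.γ → t + d ∈ Ioc (0 : ℝ) θ.γ →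
        |(objectsOfRecord₁₃ F N θ.toStage13Params ℓ).EA 0 (Function.update g i (t + d)) U X -
            2 * (objectsOfRecord₁₃ F N θ.toStage13Params ℓ).EA 0 (Function.update g i t) U X +
            (objectsOfRecord₁₃ F N θ.toStage13Params ℓ).EA 0 (Function.update g i (t - d)) U X| ≤
          M * Real.exp (-(κ * ((objectsOfRecord₁₃ F N θ.toStage13Params ℓ).levelCarriers 0).d X)) * d ^ 2)
    (hω : 0 < ℓ.ω) (hθω : ℓ.θ₅ ≤ ℓ.ω ^ 2) (hκ : ℓ.κ ≤ κ)
    (hC₉ : (4 * (2 * C₅ / (1 - ℓ.θ₅) + 2 * E₀) / θ.γ + M * θ.γ / 2) / ℓ.ω ≤ ℓ.C₉) (k : ℕ) :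
    N22At (rateCarriersOfRecord₁₃CoPH 𝔯 F θ hP g₀ os k).u3 :=
  n22At_rateCarriers_of_kernels_pin_of_ne9 𝔯 θ hP g₀ os ℓ hs hpin
    (ne9_EA_objectsOfRecord₁₃_of_kernelStepRate_secondDiff F N θ.toStage13Params ℓ hs hγ hC₅ hE₀ hM h5 hdec hR2 hω hθω hκ hC₉) k

end Record

/-! ## §3 The kernel second-difference letter from WINDOWED second differences + (1.21) existence -/

section Windowed

variable {𝔄 : Type*} [NormedRing 𝔄] [NormedAlgebra ℝ 𝔄]
variable {V : Type*} [NormedAddCommGroup V] [NormedSpace ℝ V] {ι : Type*} [Fintype ι]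
variable (F : T4Family) (ℰ : TermFamily1 F 𝔄) (ρ : V →L[ℝ] 𝔄) (bV : Module.Basis ι ℝ V)

/-- An eventual bound on the second difference of three convergent real sequences passes to their limits. [folklore] -/
theorem abs_secondDiff_le_of_tendsto {a b c : ℕ → ℝ} {A B C₀ s : ℝ} (ha : Tendsto a atTop (𝓝 A)) (hb : Tendsto b atTop (𝓝 B)) (hc : Tendsto c atTop (𝓝 C₀))
    (h : ∀ᶠ K in atTop, |a K - 2 * b K + c K| ≤ s) : |A - 2 * B + C₀| ≤ s :=
  le_of_tendsto (((ha.sub (hb.const_mul 2)).add hc).abs) h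

/-- Updating one coordinate of a window history inside `]0, γ]` stays in the window. [folklore] -/
theorem update_mem_window {γ : ℝ} {g : ℕ → ℝ} (hg : g ∈ Window γ) (i : ℕ) {s : ℝ} (hs : s ∈ Ioc (0 : ℝ) γ) : Function.update g i s ∈ Window γ := by
  intro j
  by_cases hji : j = i
  · subst hji; rw [Function.update_self]; exact ⟨hs.1, hs.2⟩
  · rw [Function.update_of_ne hji]; exact hg j

/-- ★ **THE KERNEL SECOND-DIFFERENCE LETTER (R₂) FROM WINDOWED SECOND DIFFERENCES AND THE EXISTENCE OF THE (1.21) LIMITS.**  IF at every window history and level the (1.21) limits exist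
(def-B's `PolLimitExists`, dag-n22-w3's `hlim`) and the WINDOWED finite-volume kernels have second differences in every young coupling `≤ M·e^{−κ|z|₁}·d²` EVENTUALLY IN THE VOLUME
INDEX `K` (module J39's letter — produced there from output-level coupling margins with UNIFORM radii), THEN so do the limiting kernels — §1's `hR2`.  No estimate:
`le_of_tendsto`. [folklore] -/
theorem kernelSecondDiff_of_windowed {γ κ M : ℝ}
    (hlim : ∀ g ∈ Window γ, ∀ k : ℕ, PolLimitExists F (k + 1) (fun K => ℰ k (histPrefix g k) K) ρ bV)
    (hW2 : ∀ g ∈ Window γ, ∀ (k : ℕ) (μ ν : Fin 4) (z : Fin 4 → ℤ) (i : ℕ), i < k + 1 → ∀ t d : ℝ, 0 < d →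
      t - d ∈ Ioc (0 : ℝ) γ → t + d ∈ Ioc (0 : ℝ) γ → ∀ᶠ K in atTop,
        |polWindow F K (k + 1) (ℰ k (histPrefix (Function.update g i (t + d)) k) K) ρ bV μ ν z -
            2 * polWindow F K (k + 1) (ℰ k (histPrefix (Function.update g i t) k) K) ρ bV μ ν z +
            polWindow F K (k + 1) (ℰ k (histPrefix (Function.update g i (t - d)) k) K) ρ bV μ ν z| ≤ M * Real.exp (-(κ * l1 z)) * d ^ 2) :
    ∀ g ∈ Window γ, ∀ (k : ℕ) (μ ν : Fin 4) (z : Fin 4 → ℤ) (i : ℕ), i < k + 1 → ∀ t d : ℝ, 0 < d →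
      t - d ∈ Ioc (0 : ℝ) γ → t + d ∈ Ioc (0 : ℝ) γ →
        |kernelA F ℰ ρ bV (Function.update g i (t + d)) k μ ν z - 2 * kernelA F ℰ ρ bV (Function.update g i t) k μ ν z +
            kernelA F ℰ ρ bV (Function.update g i (t - d)) k μ ν z| ≤ M * Real.exp (-(κ * l1 z)) * d ^ 2 := by
  intro g hg k μ ν z i hi t d hd hm hp
  have ht : t ∈ Ioc (0 : ℝ) γ := ⟨by linarith [hm.1], by linarith [hp.2]⟩
  rw [kernelA_eq, kernelA_eq, kernelA_eq]
  exact abs_secondDiff_le_of_tendsto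
    (tendsto_polLimit F (k + 1) _ ρ bV (hlim _ (update_mem_window hg i hp) k) μ ν z)
    (tendsto_polLimit F (k + 1) _ ρ bV (hlim _ (update_mem_window hg i ht) k) μ ν z)
    (tendsto_polLimit F (k + 1) _ ρ bV (hlim _ (update_mem_window hg i hm) k) μ ν z)
    (hW2 g hg k μ ν z i hi t d hd hm hp)

end Windowed

end YMDAG.N22.KernelFading

end
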